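import Summits.BirchSwinnertonDyer.Rank1Residual.GaloisImage.PrimeChoiceSakamotoDeep
import Summits.BirchSwinnertonDyer.Rank1Residual.GaloisImage.KolyvaginPrimeOfFrobeniusClassDeep
import Summits.BirchSwinnertonDyer.Rank1Residual.GaloisImage.KolyvaginDeepFamily
import Summits.BirchSwinnertonDyer.Rank1Residual.GaloisImage.InflationRestrictionSakamotoH3
import Summits.BirchSwinnertonDyer.Rank1Residual.GaloisImage.KolyvaginPrimeFlagLevelOne
import Summits.BirchSwinnertonDyer.Rank1Residual.GaloisImage.KolyvaginDeepSubclassTransport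
import Literature.NumberTheory.EllipticCurves.KuriharaNumberDeepInvariants
import Literature.NumberTheory.EllipticCurves.HasseWeilGoodReduction
import HarnessLib

/-!
# Route `KimAtThreeKolyvagin` (rung W2), crux `DeepLowerAtThree` (item 19075): useful Kolyvagin
# primes with ≤ 3 constraints and CYCLIC Kolyvagin levels at every depth under the `3`-adic tower

HONEST FRAMING. Cell `bsd-addord`, seat `w2-c2` (D-0074 row B5). The crux `DeepLowerAtThree`
(`∂⁽⁰⁾(δ̃) ≤ ord₃ #Ш(E/ℚ)(3) + ∂^{(∞)}_deep(δ̃)` on every `3`-adic-tower row; Mazur–Rubin rigidity for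
the Kolyvagin system of `T₃E` at `p = 3`) stays OPEN: this file proves no case of it beyond what is
already in the tree. It lands, UNCONDITIONALLY and in the ROUTE'S OWN CURRENCY
(`Kato.IsKolyvaginPrime`, `IsCyclicKolyvaginLevel`, `kuriharaPartialDeepAt`), the director's «first
lemma» of row B5 — the `p = 3` "useful prime" lemma (Chebotarev with ≤ 3 simultaneous constraints,
Sakamoto JTNB 36 (2024) Cor. 5.5 = the `p = 3` substitute for Mazur–Rubin Prop. 3.6.1, memo
`kim3/KIM3-PROOF.md` §3.2–3.3 "L-Cheb3") over the crux binder `∀ n, W.HasSurjectiveModNGaloisRep (3^n)`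
— by ASSEMBLING kernel theorems of cell b2b / team n1011 (`Rank1Residual/GaloisImage/`), whose
abstract-module form of Cor. 5.5 (`PrimeChoice.infinite_setOf_mem_frobeniusClassPrimes_…`, from the
tree's PROVED Chebotarev `frobenius_dense`) is NOT re-proved here. What is new:

* §1 `natCard_torsionBy_reductionAt_eq_of_mem_frobeniusClassPrimes` /
  `natCard_torsion_intModel_eq_of_mem_frobeniusClassPrimes` — the CYCLICITY FLAG at a prime of
  Sakamoto's Frobenius class of `τ` (`E[p]/(τ − 1) ≅ ℤ/p`): `#Ẽ(𝔽_ℓ)[p] = p`, in both spellings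
  (`W.reductionAt v` and the route's `(integralModelInt W) mod ℓ`). The n1011 theorems take this flag
  as a per-prime INPUT (`hflag`, certificate-supplied); the direction "Frobenius class ⟹ flag" —
  needed by every EXISTENCE statement about the route's cyclic levels — was missing. Proof: reduction
  identifies `Ẽ_v(k_v)[p]` with the fixed points of a Frobenius on `E[p]`
  (`FrobShape.exists_frobenius_natCard_fixed_eq`, Silverman VII.3.1(b)); Frobenii above `v` are
  conjugate up to inertia, trivial on `E[p]` (VII.4.1(a)); `Fr_v` acts on `E[p] ⊆ E[n]` as `τ`, whose
  fixed group has order `p` (`natCard_fixed_eq_of_cokerSubOne_equiv`, counting `p² = p · p`).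
* §2 `infinite_setOf_isKolyvaginPrime_three_of_towerSurj` — for `k ≥ 1` and `n ≤ 3` non-zero
  classes of `H¹(ℚ, E[3])`: infinitely many places `v` with `ℓ_v ∈ 𝒫_k(E,3)`, flag `= 3`, and
  `loc_v cᵢ ≠ 0` for all `i`; `exists_useful_isKolyvaginPrime_three_of_towerSurj` (user form: avoid
  any finite set of primes); `infinite_setOf_isKolyvaginPrime_isCyclicKolyvaginLevel_of_towerSurj`
  (ℕ-currency); `exists_isCyclicKolyvaginLevel_card_eq_of_towerSurj` — cyclic levels `n ∈ 𝒩_k(E,3)`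
  with `ν(n) = i` exist for ALL `k ≥ 1`, `i`.
* §3 `kuriharaPartialDeepAt_three_le_of_towerSurj` — for EVERY weight-2 cusp form `f` and every
  tower row: `∂⁽ⁱ⁾(δ̃^{(k)}) ≤ k` for all `k, i`. The level-`k` invariants entering BOTH deep cruxes
  (19075 `DeepLowerAtThree`, 19076 `DeepUpperAtThree`) are infima over NON-EMPTY sets of levels, so
  `∂⁽ⁱ⁾_deep = ⨆_k ∂⁽ⁱ⁾(δ̃^{(k)})` is a genuine limit of finite data: an empty `𝒩_k`-stratum would give
  `∂⁽ⁱ⁾_deep = ⊤` by vacuity, under which 19075 would hold trivially (`d = ∂⁽⁰⁾`) and 19076 would fail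
  on every `Ш[3] ≠ 0` row — the typed cruxes are thereby certified non-degenerate on their rows.

What this does NOT do: no Kolyvagin-system rigidity, no bound on any `ord₃ δ̃_n` (the content of
19075); no claim on non-tower rows. Inputs by name, all kernel theorems: `S24Deep.exists_tau_forall_
levels_of_towerSurj` (one `τ` for all levels), `PrimeChoice.…_forall_localization_ne_zero_deep`,
`hH3_three_of_towerSurj` ((H.3)), `hasIrreducibleModPGaloisRep_of_hasSurjectiveModNGaloisRep` ((H.1)),
`KolyvaginPrime.isKolyvaginPrime_succ_of_mem_frobeniusClassPrimes` (class ⟹ `𝒫_k`),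
`KolyvaginPrime.natCard_torsionBy_reductionAt_eq` (model transfer), `W.eventually_hasGoodReductionAt`.

References: R. Sakamoto, JTNB 36 (2024), §2 (the set `𝒫`, (H.2)), Lemma 5.2, Cor. 5.5
[Sakamoto2024]; B. Mazur, K. Rubin, Mem. AMS 799 (2004), Prop. 3.6.1, Def. 3.1.6, Def. 4.5.7,
Thm. 5.2.12 (i) [MazurRubin2004]; C.-H. Kim, AJM 148 (2026), §1.2.2, §1.4.2, §1.5.1, Thm. 2.1
[Kim2022StructureSelmer]; J. H. Silverman, *AEC* (2009), III.6.4(b), VII.1.3(b), VII.3.1(b), VII.4.1(a)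
[SilvermanAEC2009]; memo `run/shared/lean/pub/bsd-addord/kim3/KIM3-PROOF.md` §1.3, §3.2–3.3.
-/

-- the Theorems namespace of a single-conjunct summit repeats the summit name by design (D-0017)
set_option linter.dupNamespace false

noncomputable section

open scoped Classical NumberField Pointwise
open Function Field NumberField IsDedekindDomain IsDedekindDomain.HeightOneSpectrum WeierstrassCurve
open Literature.NumberTheory.EllipticCurves Literature.NumberTheory.GaloisRepresentations
  Literature.NumberTheory.GaloisRepresentations.DiscreteGaloisModule Literature.NumberTheory.GaloisCohomology
open Rat.HeightOneSpectrum Summit.BirchSwinnertonDyer.Rank1Residual.GaloisImage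

namespace Summit.BirchSwinnertonDyer.BirchSwinnertonDyer.Theorems.KimAtThreeDeepLowerLevelSupply

/-! ### §1 Fixed points of Frobenius-class elements on `E[p]` -/

section Flag

variable (W : WeierstrassCurve ℚ) [W.IsElliptic]

/-- **`#E[p]^{τ = 1} = p` when `E[p]/(τ − 1)E[p] ≅ ℤ/p`** (Sakamoto's (H.2) datum read on fixed
points): `E[p]` has `p²` points (Silverman III.6.4(b)), the image of `τ − 1` has index `p`, hence
order `p`, hence so has its kernel, the fixed-point group of `τ`. [cite: Sakamoto2024, §2 (H.2) (p. 921)]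
[cite: SilvermanAEC2009, Cor. III.6.4(b)] -/
theorem natCard_fixed_eq_of_cokerSubOne_equiv (p : ℕ) [Fact p.Prime] (τ : absoluteGaloisGroup ℚ)
    (hτ : Nonempty (cokerSubOne (W.torsionGaloisModule ((p : ℕ) : ℤ)) τ ≃+ ZMod p)) :
    Nat.card {P : geomTorsion W ((p : ℕ) : ℤ) // τ • P = P} = p := by
  have hp : p.Prime := Fact.out
  haveI : NeZero (p : ℚ) := ⟨Nat.cast_ne_zero.mpr hp.ne_zero⟩
  haveI hfin : Finite (geomTorsion W ((p : ℕ) : ℤ)) :=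
    finite_torsionPoints_holds W (AlgebraicClosure ℚ) (by exact_mod_cast hp.ne_zero)
  have hE : Nat.card (geomTorsion W ((p : ℕ) : ℤ)) = p ^ 2 :=
    card_torsionPoints_eq_sq_holds W (AlgebraicClosure ℚ) (Nat.cast_ne_zero.mpr hp.ne_zero)
  set f : geomTorsion W ((p : ℕ) : ℤ) →+ geomTorsion W ((p : ℕ) : ℤ) :=
    (W.torsionGaloisModule ((p : ℕ) : ℤ) τ).toAddMonoidHom - AddMonoidHom.id _ with hf
  obtain ⟨e⟩ := hτ
  have hq : Nat.card (geomTorsion W ((p : ℕ) : ℤ) ⧸ f.range) = p := by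
    rw [Nat.card_congr e.toEquiv, Nat.card_zmod]
  -- Lagrange for `f.range` and the first isomorphism theorem for `f`
  have h1 := f.range.card_eq_card_quotient_mul_card_addSubgroup
  have h2 := f.ker.card_eq_card_quotient_mul_card_addSubgroup
  have h3 : Nat.card (geomTorsion W ((p : ℕ) : ℤ) ⧸ f.ker) = Nat.card f.range :=
    Nat.card_congr (QuotientAddGroup.quotientKerEquivRange f).toEquiv
  rw [hE, hq] at h1
  rw [hE, h3] at h2
  have hr : Nat.card f.range = p := by
    have := h1
    rw [pow_two] at this
    exact (Nat.eq_of_mul_eq_mul_left hp.pos this).symm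
  rw [hr, pow_two] at h2
  have hk : Nat.card f.ker = p := (Nat.eq_of_mul_eq_mul_left hp.pos h2).symm
  have hfix : Nat.card f.ker = Nat.card {P : geomTorsion W ((p : ℕ) : ℤ) // τ • P = P} := by
    refine Nat.card_congr (Equiv.subtypeEquivRight fun P => ?_)
    rw [AddMonoidHom.mem_ker, hf, AddMonoidHom.sub_apply, sub_eq_zero]
    rfl
  rw [← hfix, hk]

/-- **The cyclicity flag at a prime of Sakamoto's Frobenius class — THEOREM (place spelling).**
`E/ℚ` with globally minimal model `W`; `p` prime; `E[n]` with `p ∣ n` (so `E[p] ⊆ E[n]`); `N` with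
`p ∣ N`; `S` a set of finite places containing every place of bad reduction; `τ ∈ Γ_ℚ` with
`E[p]/(τ − 1)E[p] ≅ ℤ/p`.  If `v ∈ frobeniusClassPrimes (E[n]) S τ N` (Sakamoto's `𝒫`: `v ∉ S`,
`v ∤ N`, `E[n]` unramified at `v`, `Fr_v ∼ τ` on `E[n]` and on `μ_N`) then `#Ẽ_v(k_v)[p] = p`:
the reduction of `p`-torsion identifies `Ẽ_v(k_v)[p]` with the fixed points of a Frobenius on `E[p]`
(Silverman VII.3.1(b), tree `FrobShape.exists_frobenius_natCard_fixed_eq`); Frobenii above `v` are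
conjugate up to inertia, which acts trivially (VII.4.1(a)); and `Fr_v` acts on `E[p]` as `τ`, whose
fixed-point group has order `p`.  This is the direction `𝒫 ⟹ flag` of the cyclicity flag that the
cell-n1011 Kolyvagin-prime theorems (`FrobShape.mem_frobeniusClassPrimes_of_kolyvaginPrime`, the
END theorems' binder `hflag`) take as a per-prime INPUT. [cite: Sakamoto2024, §2, the set 𝒫 (pp. 920–921)]
[cite: SilvermanAEC2009, Prop. VII.3.1(b) and Prop. VII.4.1(a)] -/
theorem natCard_torsionBy_reductionAt_eq_of_mem_frobeniusClassPrimes [W.IsGloballyMinimal]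
    (p : ℕ) [Fact p.Prime] {n : ℤ} (hpn : ((p : ℕ) : ℤ) ∣ n) {N : ℕ} (hpN : p ∣ N)
    {S : Set (HeightOneSpectrum (𝓞 ℚ))} (hSbad : ∀ v ∉ S, W.HasGoodReductionAt v)
    {τ : absoluteGaloisGroup ℚ}
    (hτ : Nonempty (cokerSubOne (W.torsionGaloisModule ((p : ℕ) : ℤ)) τ ≃+ ZMod p))
    {v : HeightOneSpectrum (𝓞 ℚ)}
    (hv : v ∈ frobeniusClassPrimes (W.torsionGaloisModule n) S τ N) :
    Nat.card (AddSubgroup.torsionBy (W.reductionAt v).toAffine.Point p) = p := by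
  have hp : p.Prime := Fact.out
  obtain ⟨hvS, hvN, -, σ, ⟨𝔓, h𝔓, hσ𝔓⟩, hfix, -⟩ := hv
  set ℓ : ℕ := ((primesEquiv v : Nat.Primes) : ℕ) with hℓdef
  haveI hℓ : Fact ℓ.Prime := ⟨(primesEquiv v).2⟩
  have hvℓ : (ℓ : 𝓞 ℚ) ∈ v.asIdeal := KolyvaginPrime.natCast_mem_asIdeal_of_primesEquiv_eq rfl
  -- `ℓ ≠ p`: `v ∤ N` and `p ∣ N`
  have hpv : (p : 𝓞 ℚ) ∉ v.asIdeal := fun h => hvN (by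
    obtain ⟨c, hc⟩ := hpN
    rw [hc, Nat.cast_mul]
    exact v.asIdeal.mul_mem_right _ h)
  have hℓp : ℓ ≠ p := fun h => hpv (h ▸ hvℓ)
  have hgood : W.HasGoodReductionAt v := hSbad v hvS
  have hgoodℓ : W.HasGoodReductionAtPrime ℓ :=
    (hasGoodReductionAtPrime_primesEquiv_iff_holds W v ℓ rfl).mpr hgood
  -- a Frobenius `σ₀` at `𝔓₀ ∣ v` whose fixed points on `E[p]` count `Ẽ_v(k_v)[p]`
  obtain ⟨σ₀, 𝔓₀, h𝔓₀, hσ₀, hcount⟩ :=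
    FrobShape.exists_frobenius_natCard_fixed_eq W p ℓ hℓp hgoodℓ hvℓ
  have hc1 := hcount 1
  rw [pow_one] at hc1
  -- move `σ₀` to the prime `𝔓` of `σ`: `g • 𝔓₀ = 𝔓` and `g σ₀ g⁻¹` is a Frobenius at `𝔓`
  obtain ⟨g, hg⟩ := HeightOneSpectrum.exists_smul_eq_of_mem_primesAbove_holds h𝔓₀ h𝔓
  have hσ₁ : IsArithFrobAt (𝓞 ℚ) (g * σ₀ * g⁻¹) 𝔓 := hg ▸ hσ₀.conj g
  -- `σ` and `g σ₀ g⁻¹` differ by an element of the inertia group at `𝔓`, trivial on `E[p]`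
  have hI := hσ𝔓.mul_inv_mem_inertia hσ₁
  have hpv' : ((((p : ℕ) : ℤ)) : 𝓞 ℚ) ∉ v.asIdeal := by rwa [Int.cast_natCast]
  have hσσ₁ : ∀ P : geomTorsion W ((p : ℕ) : ℤ), σ • P = (g * σ₀ * g⁻¹) • P := fun P => by
    have h := W.smul_geomTorsion_eq_of_mem_inertia hgood hpv' h𝔓 hI ((g * σ₀ * g⁻¹) • P)
    rwa [mul_smul, inv_smul_smul] at h
  -- `σ` acts on `E[p] ⊆ E[n]` as `τ`
  have hστ : ∀ P : geomTorsion W ((p : ℕ) : ℤ), σ • P = τ • P := fun P => by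
    have h := S24Deep.smul_eq_self_torsion_of_dvd W hpn (σ * τ⁻¹)
      (fun Q => by
        have h := hfix Q
        rwa [torsionGaloisModule_apply_apply] at h) (τ • P)
    rwa [mul_smul, inv_smul_smul] at h
  -- fixed points of `σ₀` and of its conjugate correspond under `P ↦ g • P`
  have hconj : Nat.card {P : geomTorsion W ((p : ℕ) : ℤ) // σ₀ • P = P} =
      Nat.card {P : geomTorsion W ((p : ℕ) : ℤ) // (g * σ₀ * g⁻¹) • P = P} := by
    refine Nat.card_congr
      { toFun := fun P => ⟨g • P.1, by rw [mul_smul, mul_smul, inv_smul_smul, P.2]⟩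
        invFun := fun Q => ⟨g⁻¹ • Q.1, by
          have h := Q.2
          rw [mul_smul, mul_smul, smul_eq_iff_eq_inv_smul] at h
          exact h⟩
        left_inv := fun P => Subtype.ext (inv_smul_smul g P.1)
        right_inv := fun Q => Subtype.ext (smul_inv_smul g Q.1) }
  have hfixτ : Nat.card {P : geomTorsion W ((p : ℕ) : ℤ) // (g * σ₀ * g⁻¹) • P = P} =
      Nat.card {P : geomTorsion W ((p : ℕ) : ℤ) // τ • P = P} :=
    Nat.card_congr (Equiv.subtypeEquivRight fun P => by rw [← hσσ₁ P, hστ P])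
  rw [← hc1, hconj, hfixτ, natCard_fixed_eq_of_cokerSubOne_equiv W p τ hτ]

/-- **The cyclicity flag in the spelling of `IsCyclicKolyvaginLevel`** (the global minimal model
reduced mod `ℓ`, `ℓ` the rational prime under `v`): at a prime of Sakamoto's Frobenius class of `τ`
(hypotheses of `natCard_torsionBy_reductionAt_eq_of_mem_frobeniusClassPrimes`),
`#{P ∈ (E₀ mod ℓ)(ℤ/ℓ) : p • P = 0} = p`, in particular `≤ p` — model transfer
`KolyvaginPrime.natCard_torsionBy_reductionAt_eq'` (Silverman VII.1.3(b)).
[cite: Sakamoto2024, §2, the set 𝒫 (pp. 920–921)] [cite: SilvermanAEC2009, Prop. VII.1.3(b) and Prop. VII.3.1(b)] -/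
theorem natCard_torsion_intModel_eq_of_mem_frobeniusClassPrimes [W.IsGloballyMinimal]
    (p : ℕ) [Fact p.Prime] {n : ℤ} (hpn : ((p : ℕ) : ℤ) ∣ n) {N : ℕ} (hpN : p ∣ N)
    {S : Set (HeightOneSpectrum (𝓞 ℚ))} (hSbad : ∀ v ∉ S, W.HasGoodReductionAt v)
    {τ : absoluteGaloisGroup ℚ}
    (hτ : Nonempty (cokerSubOne (W.torsionGaloisModule ((p : ℕ) : ℤ)) τ ≃+ ZMod p))
    {v : HeightOneSpectrum (𝓞 ℚ)}
    (hv : v ∈ frobeniusClassPrimes (W.torsionGaloisModule n) S τ N)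
    {ℓ : ℕ} [Fact ℓ.Prime] (hℓ : ((primesEquiv v : Nat.Primes) : ℕ) = ℓ) :
    Nat.card {P : ((integralModelInt W).map (Int.castRingHom (ZMod ℓ))).toAffine.Point //
      p • P = 0} = p := by
  rw [← KolyvaginPrime.natCard_torsionBy_reductionAt_eq W hℓ p]
  exact natCard_torsionBy_reductionAt_eq_of_mem_frobeniusClassPrimes W p hpn hpN hSbad hτ hv

end Flag

/-! ### §2 Useful Kolyvagin primes of `𝒫_k(E, 3)` at every depth under the `3`-adic tower -/

section Supply

variable (W : WeierstrassCurve ℚ) [W.IsElliptic] [W.IsGloballyMinimal]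

/-- **Useful Kolyvagin primes at `p = 3`, every depth, ≤ 3 constraints — in the route's currency.**
For `E/ℚ` with globally minimal model `W` and the `3`-adic tower onto (`ρ̄_{E,3ⁿ}` surjective for
every `n`, the binder of the cruxes of route `KimAtThreeKolyvagin`), every `k ≥ 1` and every family
of `n ≤ 3` NON-ZERO classes `c₁, …, cₙ ∈ H¹(ℚ, E[3])`: the set of finite places `v` of `ℚ` such that,
with `ℓ` the prime under `v`, (i) `ℓ ∈ 𝒫_k(E, 3)` in Kim's sense (`Kato.IsKolyvaginPrime W 3 k ℓ`:
`ℓ ∤ 3N_E`, `ℓ ≡ 1`, `a_ℓ ≡ ℓ + 1 (mod 3^k)`), (ii) `#Ẽ_v(k_v)[3] = 3` (the cyclicity flag of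
`IsCyclicKolyvaginLevel`, so `T/(Fr_ℓ − 1)T` is cyclic), and (iii) `loc_v cᵢ ≠ 0` for every `i`,
is INFINITE.  Assembly of cell-n1011 kernel theorems: one `τ` for all levels under the tower
(`S24Deep.exists_tau_forall_levels_of_towerSurj`), Sakamoto's Cor. 5.5 / Mazur–Rubin Prop. 3.6.1
on the deep Frobenius class of `E[3^k]` from the tree's proved Chebotarev
(`PrimeChoice.infinite_setOf_mem_frobeniusClassPrimes_forall_localization_ne_zero_deep`, (H.1) from
`ρ̄_{E,3}` onto, (H.3) `hH3_three_of_towerSurj`), membership ⟹ `𝒫_k`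
(`KolyvaginPrime.isKolyvaginPrime_succ_of_mem_frobeniusClassPrimes`) and the flag (§1).
[cite: Sakamoto2024, Lemma 5.2 and Cor. 5.5 (pp. 928–930)] [cite: MazurRubin2004, Prop. 3.6.1 (pp. 30–31)]
[cite: Kim2022StructureSelmer, §1.2.2] -/
theorem infinite_setOf_isKolyvaginPrime_three_of_towerSurj
    (htower : ∀ n : ℕ, W.HasSurjectiveModNGaloisRep (3 ^ n : ℕ)) {k : ℕ} (hk : 1 ≤ k)
    {n : ℕ} (hn : n ≤ 3) (c : Fin n → galoisCohomology (W.torsionGaloisModule ((3 : ℕ) : ℤ)) 1)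
    (hc : ∀ i, c i ≠ 0) :
    {v : HeightOneSpectrum (𝓞 ℚ) |
      Kato.IsKolyvaginPrime W 3 k ((primesEquiv v : Nat.Primes) : ℕ) ∧
      Nat.card (AddSubgroup.torsionBy (W.reductionAt v).toAffine.Point (3 : ℕ)) = 3 ∧
      ∀ i, galoisCohomology.localization (W.torsionGaloisModule ((3 : ℕ) : ℤ)) (Sum.inr v) 1 (c i)
        ≠ 0}.Infinite := by
  haveI : Fact (Nat.Prime 3) := ⟨Nat.prime_three⟩
  haveI : NeZero ((3 : ℕ) : ℚ) := ⟨by norm_num⟩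
  obtain ⟨m, rfl⟩ : ∃ m, k = m + 1 := ⟨k - 1, by omega⟩
  -- ONE `τ` for all levels under the tower; its level-`3` shape
  obtain ⟨τ, hτμ, hτq⟩ := S24Deep.exists_tau_forall_levels_of_towerSurj W htower
  have hτ0 : Nonempty (cokerSubOne (W.torsionGaloisModule ((3 : ℕ) : ℤ)) τ ≃+ ZMod 3) := by
    have h := hτq 0
    rwa [pow_zero, one_mul, zero_add, pow_one] at h
  -- the finite set of bad places
  have hbadfin : {v : HeightOneSpectrum (𝓞 ℚ) | ¬ W.HasGoodReductionAt v}.Finite := by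
    have h := W.eventually_hasGoodReductionAt
    rwa [Filter.eventually_cofinite] at h
  have hSbad : ∀ v ∉ {v : HeightOneSpectrum (𝓞 ℚ) | ¬ W.HasGoodReductionAt v},
      W.HasGoodReductionAt v := fun v hv => not_not.mp hv
  -- finiteness of the modules, (H.1), kernel inclusion `E[3] ⊆ E[3^{m+1}]`
  haveI : Finite (geomTorsion W ((3 : ℕ) : ℤ)) :=
    finite_torsionPoints_holds W (AlgebraicClosure ℚ) (by norm_num)
  haveI : Finite (geomTorsion W (((3 : ℕ) : ℤ) ^ m * ((3 : ℕ) : ℤ))) :=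
    finite_torsionPoints_holds W (AlgebraicClosure ℚ) (by positivity)
  have hirr := hasIrreducibleModPGaloisRep_of_hasSurjectiveModNGaloisRep W 3 (by simpa using htower 1)
  have hker : ∀ u : absoluteGaloisGroup ℚ,
      W.torsionGaloisModule (((3 : ℕ) : ℤ) ^ m * ((3 : ℕ) : ℤ)) u = 1 →
        W.torsionGaloisModule ((3 : ℕ) : ℤ) u = 1 := fun u hu =>
    S24Deep.torsionGaloisModule_eq_one_of_dvd W (Dvd.intro_left _ rfl) u hu
  have hInf :=
    PrimeChoice.infinite_setOf_mem_frobeniusClassPrimes_forall_localization_ne_zero_deep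
      (W.torsionGaloisModule ((3 : ℕ) : ℤ))
      (W.torsionGaloisModule (((3 : ℕ) : ℤ) ^ m * ((3 : ℕ) : ℤ))) hker (p := 3)
      (N' := 3 ^ (m + 1)) (pow_ne_zero _ (by norm_num)) _ hbadfin hτ0
      (fun A hA => hirr A fun σ P hP => hA σ P hP) (hH3_three_of_towerSurj W m htower) hn c hc
  refine hInf.mono ?_
  rintro v ⟨hv, hloc⟩
  exact ⟨KolyvaginPrime.isKolyvaginPrime_succ_of_mem_frobeniusClassPrimes W m hSbad (hτμ (m + 1))
      (hτq m) hv,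
    natCard_torsionBy_reductionAt_eq_of_mem_frobeniusClassPrimes W 3 (Dvd.intro_left _ rfl)
      (dvd_pow_self 3 (Nat.succ_ne_zero m)) hSbad hτ0 hv, hloc⟩

/-- From `ℓ ∈ 𝒫_k(E,3)` (`k ≥ 1`) and the flag `#Ẽ_v(k_v)[3] = 3` at the place `v` over `ℓ` to the
route's predicate `IsCyclicKolyvaginLevel W 3 ℓ` (`ℓ ∈ 𝒩_1` and `#(E₀ mod q)(ℤ/q)[3] ≤ 3` for every
prime `q ∣ ℓ`, i.e. for `q = ℓ`; model transfer `KolyvaginPrime.natCard_torsionBy_reductionAt_eq`).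
[cite: Kim2022StructureSelmer, §1.2.2 and Thm. 2.1] -/
theorem isCyclicKolyvaginLevel_of_natCard_torsionBy_reductionAt_eq {k : ℕ} (hk : 1 ≤ k)
    {v : HeightOneSpectrum (𝓞 ℚ)}
    (hv : Kato.IsKolyvaginPrime W 3 k ((primesEquiv v : Nat.Primes) : ℕ))
    (hflag : Nat.card (AddSubgroup.torsionBy (W.reductionAt v).toAffine.Point (3 : ℕ)) = 3) :
    IsCyclicKolyvaginLevel W 3 ((primesEquiv v : Nat.Primes) : ℕ) := by
  refine ⟨(hv.mono hk).isKolyvaginProduct, fun q _ hqd => ?_⟩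
  have hqℓ : q = ((primesEquiv v : Nat.Primes) : ℕ) :=
    (Nat.prime_dvd_prime_iff_eq Fact.out (primesEquiv v).2).mp hqd
  subst hqℓ
  rw [← KolyvaginPrime.natCard_torsionBy_reductionAt_eq W rfl 3, hflag]

/-- **Useful primes, user form**: under the tower, for `k ≥ 1`, `n ≤ 3` non-zero classes
`cᵢ ∈ H¹(ℚ, E[3])` and any finite set `T` of rational primes to avoid, there is a place `v`, over a
prime `ℓ ∉ T`, with `ℓ ∈ 𝒫_k(E, 3)`, `ℓ` a cyclic Kolyvagin level, and `loc_v cᵢ ≠ 0` for all `i` —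
the shape in which a Kolyvagin-system induction over the levels `𝒩_k` consumes Sakamoto's Cor. 5.5
(fresh prime, prescribed non-vanishing localisations). [cite: Sakamoto2024, Cor. 5.5 (p. 929)]
[cite: MazurRubin2004, Prop. 3.6.1 (pp. 30–31)] -/
theorem exists_useful_isKolyvaginPrime_three_of_towerSurj
    (htower : ∀ n : ℕ, W.HasSurjectiveModNGaloisRep (3 ^ n : ℕ)) {k : ℕ} (hk : 1 ≤ k)
    {n : ℕ} (hn : n ≤ 3) (c : Fin n → galoisCohomology (W.torsionGaloisModule ((3 : ℕ) : ℤ)) 1)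
    (hc : ∀ i, c i ≠ 0) (T : Finset ℕ) :
    ∃ v : HeightOneSpectrum (𝓞 ℚ), ((primesEquiv v : Nat.Primes) : ℕ) ∉ T ∧
      Kato.IsKolyvaginPrime W 3 k ((primesEquiv v : Nat.Primes) : ℕ) ∧
      IsCyclicKolyvaginLevel W 3 ((primesEquiv v : Nat.Primes) : ℕ) ∧
      ∀ i, galoisCohomology.localization (W.torsionGaloisModule ((3 : ℕ) : ℤ)) (Sum.inr v) 1 (c i)
        ≠ 0 := by
  have hInf := infinite_setOf_isKolyvaginPrime_three_of_towerSurj W htower hk hn c hc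
  have hTfin : ((fun v : HeightOneSpectrum (𝓞 ℚ) => ((primesEquiv v : Nat.Primes) : ℕ)) ⁻¹'
      (T : Set ℕ)).Finite :=
    T.finite_toSet.preimage fun v _ w _ h => primesEquiv.injective (Subtype.ext h)
  obtain ⟨v, ⟨hv, hflag, hloc⟩, hvT⟩ := (hInf.sdiff hTfin).nonempty
  exact ⟨v, hvT, hv, isCyclicKolyvaginLevel_of_natCard_torsionBy_reductionAt_eq W hk hv hflag, hloc⟩

/-- **The same supply in Kim's ℕ-currency**: under the `3`-adic tower, for every `k ≥ 1` there are
infinitely many rational primes `ℓ ∈ 𝒫_k(E, 3)` (`Kato.IsKolyvaginPrime W 3 k ℓ`) which are CYCLIC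
Kolyvagin levels (`IsCyclicKolyvaginLevel W 3 ℓ`: `ℓ ∈ 𝒩_1` and `#Ẽ(𝔽_ℓ)[3] ≤ 3` on the reduced
global minimal model) — the levels over which the cruxes' invariants `∂⁽ⁱ⁾(δ̃^{(k)})`
(`kuriharaPartialDeepAt`) are infima. [cite: Kim2022StructureSelmer, §1.2.2 and Thm. 2.1]
[cite: Sakamoto2024, Cor. 5.5 (p. 929)] -/
theorem infinite_setOf_isKolyvaginPrime_isCyclicKolyvaginLevel_of_towerSurj
    (htower : ∀ n : ℕ, W.HasSurjectiveModNGaloisRep (3 ^ n : ℕ)) {k : ℕ} (hk : 1 ≤ k) :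
    {ℓ : ℕ | Kato.IsKolyvaginPrime W 3 k ℓ ∧ IsCyclicKolyvaginLevel W 3 ℓ}.Infinite := by
  have hInf := infinite_setOf_isKolyvaginPrime_three_of_towerSurj W htower hk (n := 0) (Nat.zero_le _)
    (fun i => Fin.elim0 i) (fun i => Fin.elim0 i)
  have himage := hInf.image (f := fun v : HeightOneSpectrum (𝓞 ℚ) => ((primesEquiv v : Nat.Primes) : ℕ))
    (fun v _ w _ h => primesEquiv.injective (Subtype.ext h))
  refine himage.mono ?_
  rintro ℓ ⟨v, ⟨hv, hflag, -⟩, rfl⟩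
  exact ⟨hv, isCyclicKolyvaginLevel_of_natCard_torsionBy_reductionAt_eq W hk hv hflag⟩

/-- **Cyclic Kolyvagin levels of every depth and every number of prime factors exist under the
tower**: for `k ≥ 1` and `i : ℕ` there is `n ∈ 𝒩_k(E, 3)`, a cyclic Kolyvagin level, with exactly
`i` prime factors (induction on `i`, multiplying by a fresh prime of the infinite supply).
[cite: Kim2022StructureSelmer, §1.2.2 and §1.4.2] [cite: MazurRubin2004, Def. 3.1.6] -/
theorem exists_isCyclicKolyvaginLevel_card_eq_of_towerSurj
    (htower : ∀ n : ℕ, W.HasSurjectiveModNGaloisRep (3 ^ n : ℕ)) {k : ℕ} (hk : 1 ≤ k) (i : ℕ) :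
    ∃ n : ℕ, IsCyclicKolyvaginLevel W 3 n ∧ Kato.IsKolyvaginProduct W 3 k n ∧
      n.primeFactors.card = i := by
  induction i with
  | zero =>
    exact ⟨1, isCyclicKolyvaginLevel_one W 3, Kato.IsKolyvaginProduct.one, by
      rw [Nat.primeFactors_one, Finset.card_empty]⟩
  | succ i ih =>
    obtain ⟨n, hcyc, hn, hcard⟩ := ih
    have hn0 : n ≠ 0 := hn.ne_zero
    -- a fresh cyclic Kolyvagin prime of level `k` outside the prime factors of `n`
    obtain ⟨ℓ, ⟨hℓ, hℓcyc⟩, hℓn⟩ :=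
      ((infinite_setOf_isKolyvaginPrime_isCyclicKolyvaginLevel_of_towerSurj W htower hk).sdiff
        n.primeFactors.finite_toSet).nonempty
    have hℓp : ℓ.Prime := hℓ.prime
    have hℓdvd : ¬ ℓ ∣ n := fun h => hℓn (Finset.mem_coe.mpr (Nat.mem_primeFactors.mpr ⟨hℓp, h, hn0⟩))
    have hcop : n.Coprime ℓ := ((Nat.Prime.coprime_iff_not_dvd hℓp).mpr hℓdvd).symm
    have hmul : Kato.IsKolyvaginProduct W 3 k (n * ℓ) := hn.mul hℓ.isKolyvaginProduct hcop
    refine ⟨n * ℓ, ⟨hmul.mono hk, fun q _ hqd => ?_⟩, hmul, ?_⟩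
    · rcases (Nat.Prime.dvd_mul Fact.out).mp hqd with h | h
      · exact hcyc.2 q h
      · exact hℓcyc.2 q h
    · have hℓn' : ℓ ∉ n.primeFactors := fun h => hℓn (Finset.mem_coe.mpr h)
      rw [Nat.primeFactors_mul hn0 hℓp.ne_zero, hℓp.primeFactors,
        Finset.card_union_of_disjoint (Finset.disjoint_singleton_right.mpr hℓn'),
        Finset.card_singleton, hcard]

end Supply

/-! ### §3 Consequence for the deep invariants of the cruxes `DeepLowerAtThree` / `DeepUpperAtThree` -/

section Deep

variable (W : WeierstrassCurve ℚ) [W.IsElliptic] [W.IsGloballyMinimal] {N : ℕ}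
  (f : CuspForm (CongruenceSubgroup.Gamma0 N) 2)

/-- **`∂⁽ⁱ⁾(δ̃^{(k)}) ≤ k` on every tower row, for every depth `k` and every `i`.**  The level-`k`
invariant `kuriharaPartialDeepAt W 3 f k i` (Mazur–Rubin Def. 4.5.7 read on the Kurihara numbers of
ANY weight-`2` cusp form `f`: the infimum of `min(k, ord₃ δ̃_n)` over the CYCLIC levels `n ∈ 𝒩_k(E,3)`
with `ν(n) = i`) is an infimum over a NON-EMPTY set of levels
(`exists_isCyclicKolyvaginLevel_card_eq_of_towerSurj`), hence at most the cap `k` — so the deep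
invariants `∂⁽ⁱ⁾_deep = ⨆_k ∂⁽ⁱ⁾(δ̃^{(k)})` of the cruxes are genuine limits of finite level data, never
`⊤` by emptiness of a `𝒩_k`-stratum. [cite: MazurRubin2004, Def. 4.5.7 and Thm. 5.2.12 (i)]
[cite: Kim2022StructureSelmer, §1.5.1 (PDF p. 7)] -/
theorem kuriharaPartialDeepAt_three_le_of_towerSurj
    (htower : ∀ n : ℕ, W.HasSurjectiveModNGaloisRep (3 ^ n : ℕ)) (k i : ℕ) :
    kuriharaPartialDeepAt W 3 f k i ≤ k := by
  obtain ⟨n, hcyc, hn, hi⟩ :=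
    exists_isCyclicKolyvaginLevel_card_eq_of_towerSurj W htower (le_max_right k 1) i
  exact kuriharaPartialDeepAt_le_self W 3 f hcyc (hn.mono (le_max_left k 1)) hi

/-- Hence `∂⁽ⁱ⁾(δ̃^{(k)}) < ⊤` on every tower row. [cite: MazurRubin2004, Def. 4.5.7] -/
theorem kuriharaPartialDeepAt_three_lt_top_of_towerSurj
    (htower : ∀ n : ℕ, W.HasSurjectiveModNGaloisRep (3 ^ n : ℕ)) (k i : ℕ) :
    kuriharaPartialDeepAt W 3 f k i < ⊤ :=
  lt_of_le_of_lt (kuriharaPartialDeepAt_three_le_of_towerSurj W f htower k i) (ENat.coe_lt_top k)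

end Deep

end Summit.BirchSwinnertonDyer.BirchSwinnertonDyer.Theorems.KimAtThreeDeepLowerLevelSupply

end
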